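import Summits.Ventures.PercRepro.LemmaBPointed

/-!
# Lemma B for three-block maps: crossing cells generated by a partition of the coordinates

A regime of Lemma B in which every crossing cell has a unique minimal element and the three
minimal elements partition the coordinates: `M 0 ⊔ M 1 ⊔ M 2 = ⊤`, the blocks pairwise disjoint,
`c (M i) = cross4 i`, and every `ω` with `c ω = cross4 i` contains `M i` (`ThreeBlock c M`).

Every bad pair `{ω, ωᶜ}` (`c ω = x_i`, `c ωᶜ = x_j`, `i < j`) is then `{M i ⊔ P, M j ⊔ (M k ∖ P)}`
for the third block `k` and a nonempty proper trace `P = ω ∖ M i ≤ M k`, and `{P, Pᶜ}` is a good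
pair: `P ≤ ω` and `P ≤ M k` give `c P ≤ x_i ⊓ x_k = ⊥`, while `Pᶜ ≥ M i ⊔ M j` gives `c Pᶜ = ⊤`. The
map `ω ↦ Pᶜ = (ω ∖ blocksBelow M ω)ᶜ` is injective on the bad set (the trace `P ≠ ⊥` determines the
block `k` it lies in, hence `i < j`, hence `ω = M i ⊔ P`), and `⊤` (the good pair `{∅, ⊤}`) is not in
its image. Hence `crossCount + 1 ≤ topBotCount`
(`crossCount_add_one_le_topBotCount_of_threeBlock`).

The axis family of `proofs/P4-gen9.md` §12.8 (three disjoint axes, `c W = ⨆ {x_i | A_i ≤ W}`) is a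
three-block map with `topBotCount = crossCount + 1` for every axis length, so the bound is sharp;
subdivided `K₄` graphs (six edge-disjoint terminal paths, no other edges) are three-block maps too.
-/

namespace PercRepro

open Finset

variable {S : Type} [Fintype S] [DecidableEq S]

/-- **Three-block structure** for a map `c : Config S → Setoid (Fin 4)`: three pairwise disjoint
blocks `M 0, M 1, M 2` covering the coordinates, `M i` in the crossing cell `x_i`, and every member
of the crossing cell `x_i` containing `M i`. -/
structure ThreeBlock (c : Config S → Setoid (Fin 4)) (M : Fin 3 → Config S) : Prop where
  sup_eq_top : M 0 ⊔ M 1 ⊔ M 2 = ⊤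
  inf_eq_bot : ∀ {i j : Fin 3}, i ≠ j → M i ⊓ M j = ⊥
  cell : ∀ i, c (M i) = cross4 i
  le_of_eq : ∀ i ω, c ω = cross4 i → M i ≤ ω

/-- The index of the third block: `thirdBlock i j = -i - j` in `Fin 3`
(`thirdBlock 0 1 = 2`, `thirdBlock 0 2 = 1`, `thirdBlock 1 2 = 0`). -/
def thirdBlock (i j : Fin 3) : Fin 3 := -i - j

/-- The thirdBlock index differs from both `i` and `j` when `i < j`. -/
theorem thirdBlock_ne {i j : Fin 3} (h : i < j) : i ≠ thirdBlock i j ∧ j ≠ thirdBlock i j := by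
  revert h; revert i j; decide

/-- Two increasing pairs with the same thirdBlock index coincide. -/
theorem eq_of_thirdBlock_eq {i₁ j₁ i₂ j₂ : Fin 3} (h₁ : i₁ < j₁) (h₂ : i₂ < j₂)
    (h : thirdBlock i₁ j₁ = thirdBlock i₂ j₂) : i₁ = i₂ ∧ j₁ = j₂ := by
  revert h h₁ h₂; revert i₁ j₁ i₂ j₂; decide

/-- The three increasing pairs of `Fin 3`. -/
theorem lt_cases_fin3 {i j : Fin 3} (h : i < j) :
    (i = 0 ∧ j = 1) ∨ (i = 0 ∧ j = 2) ∨ (i = 1 ∧ j = 2) := by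
  revert h; revert i j; decide

omit [Fintype S] [DecidableEq S] in
/-- The three blocks in the order `i, j, thirdBlock i j` still cover the coordinates. -/
theorem ThreeBlock.sup_third {c : Config S → Setoid (Fin 4)} {M : Fin 3 → Config S}
    (hM : ThreeBlock c M) {i j : Fin 3} (h : i < j) : M i ⊔ M j ⊔ M (thirdBlock i j) = ⊤ := by
  rw [← hM.sup_eq_top]
  rcases lt_cases_fin3 h with ⟨rfl, rfl⟩ | ⟨rfl, rfl⟩ | ⟨rfl, rfl⟩
  · rw [show thirdBlock 0 1 = 2 by decide]
  · rw [show thirdBlock 0 2 = 1 by decide]; ac_rfl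
  · rw [show thirdBlock 1 2 = 0 by decide]; ac_rfl

/-- Distinct crossing cells are incomparable (local form). -/
theorem cross4_not_le_of_ne' {i k : Fin 3} (hik : i ≠ k) : ¬ cross4 i ≤ cross4 k := by
  intro h
  have hinf : cross4 i ⊓ cross4 k = cross4 i := inf_eq_left.2 h
  rw [cross4_inf_eq_bot hik] at hinf
  exact cross4_ne_bot i hinf.symm

section Blocks

variable (M : Fin 3 → Config S)

open Classical in
/-- The union of the blocks contained in `ω`. -/
noncomputable def blocksBelow (ω : Config S) : Config S :=
  (Finset.univ.filter fun l => M l ≤ ω).sup M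

open Classical in
/-- The block-trace map: `ω ↦ (ω ∖ blocksBelow M ω)ᶜ`; on a bad `ω` of type `(i, j)` it is the
complement of the trace `ω ∖ M i`. -/
noncomputable def blockTrace (ω : Config S) : Config S := (ω \ blocksBelow M ω)ᶜ

variable {M}

omit [Fintype S] [DecidableEq S] in
/-- If exactly the block `M i` lies below `ω`, then `blocksBelow M ω = M i`. -/
theorem blocksBelow_eq {ω : Config S} {i : Fin 3} (hi : M i ≤ ω)
    (hne : ∀ l, l ≠ i → ¬ M l ≤ ω) : blocksBelow M ω = M i := by
  classical
  have hf : (Finset.univ.filter fun l => M l ≤ ω) = {i} := by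
    ext l
    simp only [Finset.mem_filter, Finset.mem_univ, true_and, Finset.mem_singleton]
    constructor
    · intro hl
      by_contra hli
      exact hne l hli hl
    · rintro rfl
      exact hi
  unfold blocksBelow
  rw [hf, Finset.sup_singleton]

end Blocks

section Main

variable {c : Config S → Setoid (Fin 4)} {M : Fin 3 → Config S}

omit [Fintype S] [DecidableEq S] in
/-- For a bad `ω` of type `(i, j)`, no block other than `M i` lies below `ω`. -/
theorem ThreeBlock.not_le_of_ne (hM : ThreeBlock c M) (hc : Monotone c) {ω : Config S} {i : Fin 3}
    (hω : c ω = cross4 i) {l : Fin 3} (hl : l ≠ i) : ¬ M l ≤ ω := by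
  intro h
  have := hc h
  rw [hM.cell l, hω] at this
  exact cross4_not_le_of_ne' hl this

omit [Fintype S] [DecidableEq S] in
/-- The trace of a bad `ω` of type `(i, j)` lies in the third block. -/
theorem ThreeBlock.sdiff_le_third (hM : ThreeBlock c M) {ω : Config S}
    {i j : Fin 3} (hij : i < j) (hj : c ωᶜ = cross4 j) :
    ω \ M i ≤ M (thirdBlock i j) := by
  have hMj : M j ≤ ωᶜ := hM.le_of_eq j ωᶜ hj
  have hdisj : ω ⊓ M j = ⊥ := by
    rw [← le_bot_iff]
    calc ω ⊓ M j ≤ ω ⊓ ωᶜ := inf_le_inf_left ω hMj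
      _ = ⊥ := inf_compl_eq_bot
  have hle : ω ≤ M i ⊔ M (thirdBlock i j) := by
    have h1 : ω = ω ⊓ (M i ⊔ M j ⊔ M (thirdBlock i j)) := by rw [hM.sup_third hij, inf_top_eq]
    calc ω = ω ⊓ (M i ⊔ M j ⊔ M (thirdBlock i j)) := h1
      _ = ω ⊓ M i ⊔ ω ⊓ M j ⊔ ω ⊓ M (thirdBlock i j) := by rw [inf_sup_left, inf_sup_left]
      _ = ω ⊓ M i ⊔ ω ⊓ M (thirdBlock i j) := by rw [hdisj, sup_bot_eq]
      _ ≤ M i ⊔ M (thirdBlock i j) := sup_le_sup inf_le_right inf_le_right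
  calc ω \ M i ≤ (M i ⊔ M (thirdBlock i j)) \ M i := sdiff_le_sdiff_right hle
    _ = M (thirdBlock i j) \ M i := sup_sdiff_left_self
    _ ≤ M (thirdBlock i j) := sdiff_le

omit [Fintype S] [DecidableEq S] in
/-- On a bad `ω` of type `(i, j)` the block-trace map is the complement of `ω ∖ M i`. -/
theorem ThreeBlock.blockTrace_eq (hM : ThreeBlock c M) (hc : Monotone c) {ω : Config S}
    {i : Fin 3} (hi : c ω = cross4 i) : blockTrace M ω = (ω \ M i)ᶜ := by
  have hne : ∀ l, l ≠ i → ¬ M l ≤ ω := fun l hl => hM.not_le_of_ne hc hi hl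
  unfold blockTrace
  rw [blocksBelow_eq (hM.le_of_eq i ω hi) hne]

/-- The trace of a bad configuration is the `⊥`-member of a good pair: its complement has cell `⊤`
and it has cell `⊥`. -/
theorem ThreeBlock.blockTrace_mem_goodSet (hM : ThreeBlock c M) (hc : Monotone c) {ω : Config S}
    (hω : ω ∈ badSet cross4 c) : blockTrace M ω ∈ goodSet c := by
  classical
  obtain ⟨-, i, j, hij, hi, hj⟩ := Finset.mem_filter.1 hω
  rw [hM.blockTrace_eq hc hi]
  refine Finset.mem_filter.2 ⟨Finset.mem_univ _, ?_, ?_⟩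
  · -- `c (ω ∖ M i)ᶜ = ⊤`: the complement contains `M i ⊔ M j`.
    refine top_unique ?_
    rw [← cross4_sup_eq_top hij.ne]
    have hMj : M j ≤ ωᶜ := hM.le_of_eq j ωᶜ hj
    have h1 : M i ≤ (ω \ M i)ᶜ := by
      rw [sdiff_eq, compl_inf, compl_compl]
      exact le_sup_right
    have h2 : M j ≤ (ω \ M i)ᶜ := by
      rw [sdiff_eq, compl_inf, compl_compl]
      exact le_sup_of_le_left hMj
    refine sup_le ?_ ?_
    · rw [← hM.cell i]; exact hc h1
    · rw [← hM.cell j]; exact hc h2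
  · -- `c (ω ∖ M i) = ⊥`: the trace lies below `ω` (cell `x_i`) and below `M (thirdBlock i j)`.
    rw [compl_compl]
    refine le_bot_iff.1 ?_
    rw [← cross4_inf_eq_bot (thirdBlock_ne hij).1]
    refine le_inf ?_ ?_
    · rw [← hi]; exact hc sdiff_le
    · rw [← hM.cell (thirdBlock i j)]; exact hc (hM.sdiff_le_third hij hj)

omit [Fintype S] [DecidableEq S] in
/-- A bad configuration is not a block: its trace is nonempty. -/
theorem ThreeBlock.sdiff_ne_bot (hM : ThreeBlock c M) (hc : Monotone c) {ω : Config S}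
    {i j : Fin 3} (hij : i < j) (hi : c ω = cross4 i) (hj : c ωᶜ = cross4 j) : ω \ M i ≠ ⊥ := by
  intro h0
  have hωi : ω = M i := le_antisymm (by rwa [sdiff_eq_bot_iff] at h0) (hM.le_of_eq i ω hi)
  -- then `ωᶜ = (M i)ᶜ ≥ M j ⊔ M (thirdBlock i j)`, so `c ωᶜ = ⊤`, not a crossing cell.
  have hk := thirdBlock_ne hij
  have hjc : M j ≤ ωᶜ := hM.le_of_eq j ωᶜ hj
  have hkc : M (thirdBlock i j) ≤ ωᶜ := by
    rw [hωi, le_compl_iff_disjoint_right, disjoint_iff]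
    exact hM.inf_eq_bot hk.1.symm
  have htop : c ωᶜ = ⊤ := by
    refine top_unique ?_
    rw [← cross4_sup_eq_top hk.2]
    refine sup_le ?_ ?_
    · rw [← hM.cell j]; exact hc hjc
    · rw [← hM.cell (thirdBlock i j)]; exact hc hkc
  rw [hj] at htop
  -- a crossing cell is not `⊤`: it meets the other crossing cell `k` in `⊥`.
  have := cross4_inf_eq_bot hk.2
  rw [htop, top_inf_eq] at this
  exact cross4_ne_bot (thirdBlock i j) this

/-- The block-trace map is injective on the bad set. -/
theorem ThreeBlock.blockTrace_injOn (hM : ThreeBlock c M) (hc : Monotone c) :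
    Set.InjOn (blockTrace M) (badSet cross4 c : Set (Config S)) := by
  classical
  intro ω₁ hω₁ ω₂ hω₂ heq
  obtain ⟨-, i₁, j₁, hij₁, hi₁, hj₁⟩ := Finset.mem_filter.1 (Finset.mem_coe.1 hω₁)
  obtain ⟨-, i₂, j₂, hij₂, hi₂, hj₂⟩ := Finset.mem_filter.1 (Finset.mem_coe.1 hω₂)
  rw [hM.blockTrace_eq hc hi₁, hM.blockTrace_eq hc hi₂, compl_inj_iff] at heq
  -- the common trace `P` is nonempty and lies in both third blocks, so the third blocks agree.
  have hP1 : ω₁ \ M i₁ ≤ M (thirdBlock i₁ j₁) := hM.sdiff_le_third hij₁ hj₁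
  have hP2 : ω₂ \ M i₂ ≤ M (thirdBlock i₂ j₂) := hM.sdiff_le_third hij₂ hj₂
  have hne : ω₁ \ M i₁ ≠ ⊥ := hM.sdiff_ne_bot hc hij₁ hi₁ hj₁
  have hk : thirdBlock i₁ j₁ = thirdBlock i₂ j₂ := by
    by_contra hkk
    apply hne
    rw [← le_bot_iff, ← hM.inf_eq_bot hkk]
    exact le_inf hP1 (heq ▸ hP2)
  obtain ⟨rfl, -⟩ := eq_of_thirdBlock_eq hij₁ hij₂ hk
  -- same lower block and same trace: `ω = M i ⊔ (ω ∖ M i)`.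
  have h1 : ω₁ = M i₁ ⊔ ω₁ \ M i₁ := (sup_sdiff_cancel_right (hM.le_of_eq i₁ ω₁ hi₁)).symm
  have h2 : ω₂ = M i₁ ⊔ ω₂ \ M i₁ := (sup_sdiff_cancel_right (hM.le_of_eq i₁ ω₂ hi₂)).symm
  rw [h1, h2, heq]

/-- `⊤` is a good member (the pair `{∅, ⊤}`) but not a block-trace of a bad configuration. -/
theorem ThreeBlock.top_mem_goodSet (hM : ThreeBlock c M) (hc : Monotone c) :
    (⊤ : Config S) ∈ goodSet c := by
  classical
  refine Finset.mem_filter.2 ⟨Finset.mem_univ _, ?_, ?_⟩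
  · refine top_unique ?_
    rw [← cross4_sup_eq_top (show (0 : Fin 3) ≠ 1 by decide)]
    refine sup_le ?_ ?_
    · rw [← hM.cell 0]; exact hc le_top
    · rw [← hM.cell 1]; exact hc le_top
  · rw [compl_top]
    refine le_bot_iff.1 ?_
    rw [← cross4_inf_eq_bot (show (0 : Fin 3) ≠ 1 by decide)]
    refine le_inf ?_ ?_
    · rw [← hM.cell 0]; exact hc bot_le
    · rw [← hM.cell 1]; exact hc bot_le

/-- The block-trace of a bad configuration is never `⊤`. -/
theorem ThreeBlock.blockTrace_ne_top (hM : ThreeBlock c M) (hc : Monotone c) {ω : Config S}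
    (hω : ω ∈ badSet cross4 c) : blockTrace M ω ≠ ⊤ := by
  classical
  obtain ⟨-, i, j, hij, hi, hj⟩ := Finset.mem_filter.1 hω
  rw [hM.blockTrace_eq hc hi, Ne, compl_eq_top]
  exact hM.sdiff_ne_bot hc hij hi hj

/-- **Lemma B for three-block maps, with the slack `1` of the pair `{∅, ⊤}`**: for every monotone
`c : Config S → Setoid (Fin 4)` whose crossing cells are generated by a partition
`M 0 ⊔ M 1 ⊔ M 2 = ⊤` of the coordinates (`ThreeBlock c M`),
`crossCount cross4 c + 1 ≤ topBotCount c`. -/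
theorem crossCount_add_one_le_topBotCount_of_threeBlock (c : Config S → Setoid (Fin 4))
    (hc : Monotone c) (M : Fin 3 → Config S) (hM : ThreeBlock c M) :
    crossCount cross4 c + 1 ≤ topBotCount c := by
  classical
  rw [crossCount_eq_card_badSet, topBotCount_eq_card_goodSet]
  have hmaps : ∀ ω ∈ badSet cross4 c, blockTrace M ω ∈ (goodSet c).erase ⊤ := fun ω hω =>
    Finset.mem_erase.2 ⟨hM.blockTrace_ne_top hc hω, hM.blockTrace_mem_goodSet hc hω⟩
  have h1 : (badSet cross4 c).card ≤ ((goodSet c).erase ⊤).card :=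
    Finset.card_le_card_of_injOn (blockTrace M) hmaps (hM.blockTrace_injOn hc)
  have h2 : ((goodSet c).erase ⊤).card + 1 = (goodSet c).card :=
    Finset.card_erase_add_one (hM.top_mem_goodSet hc)
  omega

/-- **Lemma B for three-block maps**: `crossCount cross4 c ≤ topBotCount c` whenever the crossing
cells of the monotone map `c` are generated by a partition of the coordinates. -/
theorem crossCount_le_topBotCount_of_threeBlock (c : Config S → Setoid (Fin 4)) (hc : Monotone c)
    (M : Fin 3 → Config S) (hM : ThreeBlock c M) : crossCount cross4 c ≤ topBotCount c :=
  Nat.le_of_succ_le (crossCount_add_one_le_topBotCount_of_threeBlock c hc M hM)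

end Main

end PercRepro
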